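import Summits.CriticalPhenomena.SAWScalingLimit.Theses.SAWDefectDecoherence
import Summits.CriticalPhenomena.SAWScalingLimit.Theorems.SAWDefectDecoherenceMassRatioRenewalCut
import Summits.CriticalPhenomena.SAWScalingLimit.Theorems.SAWDefectDecoherenceMassRatioRenewalDictionaryB
import Summits.CriticalPhenomena.SAWScalingLimit.Theorems.SAWDefectDecoherenceMassRatioRenewalSurgeryB
import Summits.CriticalPhenomena.SAWScalingLimit.Theorems.SAWDefectDecoherenceMassRatioRenewalBlockModule
import Summits.CriticalPhenomena.SAWScalingLimit.Theorems.MassRatio.Negative.RowsB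
import Summits.CriticalPhenomena.SAWScalingLimit.Theorems.MassRatio.Negative.Component
import Literature.Probability.RandomPlanarGeometry.HexSAWBridgeDecay

/-!
# Crux `SAWDefectDecoherence.MassRatio` (stmt-CriticalPhenomena-8550), line `renewal-averaging-at-b` — the GLUE

The composition of the line, landed so that the crux's reduction is durable: from the three remaining
registered statements of the line — `RenewalBlock` (dyadic block regularity of the Duminil-Copin–Smirnov
bridge sequence `T ↦ B_T = HV.stripBlim T`), `LateralConfinement` (uniform-in-scale lateral tightness of
the renewal kernel's block mass) and `ArcMassRatio` (the kernel-weighted arc mass ratio at the cut `3/4`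
over macroscopic boxes of aspect `A`) — all three INLINED verbatim as hypotheses, the theorem
`massRatio_of_hyps` concludes `SAWDefectDecoherence.MassRatio` by name. It consumes the LANDED b-side
module (`stub_blockModule stub_bridgeDictionary stub_renewalSurgery`: a floor `p₁ ≤ boxMass(t, W(t))` at
every large scale and every door) and the LANDED renewal cut (`stub_renewalCut`), plus the frame lemmas
proved here: `Glue.frame_door` (eventually `b_δ` is a door edge `door (m δ) p` of the exact half-lattice,
outer endpoint off `Λ_δ` — from `b_δ ∈ ∂Λ_δ`, `δ·b_δ → b` and the rows clause), `Glue.frame_box`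
(eventually the box `Rect (m δ) (m δ + 2t) (p - At) (p + At)` lies in `Λ_δ`, `t = tOf D ρ A δ`),
`Glue.eventually_le_tOf` (`t(δ) → ∞`; uses `ρ > 0` and `D.pt 0 ≠ D.pt 1`). The registered sub-goal of the
crux item proved here is `massRatio_of_hyps`. Sources: the line card
`Cruxes/MassRatio/Lines/renewal-averaging-at-b.md`; H. Kesten, J. Math. Phys. 4 (1963); N. Madras,
G. Slade, *The Self-Avoiding Walk* (1993) §4.2; H. Duminil-Copin, S. Smirnov, Ann. of Math. 175 (2012) §3.
-/

noncomputable section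

namespace Summit.CriticalPhenomena.SAWScalingLimit.Theorems.MassRatio.Renewal

open Literature.Probability.LatticeModels Literature.Probability.RandomPlanarGeometry
open Literature.Probability.RandomPlanarGeometry.SAW
open Summit.CriticalPhenomena.SAWScalingLimit.Theses.SAWDefectDecoherence
open Summit.CriticalPhenomena.SAWScalingLimit.Theorems.MassRatio.Negative

namespace Glue

/-! ## Glue (proved) -/

/-- `Z ≥ 0`. -/
theorem Z_nonneg (Λ : Finset HexVertex) (a z : Sym2 HexVertex) : 0 ≤ Z Λ a z := norm_nonneg _

/-- `cutSum ≥ 0`. -/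
theorem cutSum_nonneg (Λ : Finset HexVertex) (a : Sym2 HexVertex) (m p : ℤ) (t W : ℕ) :
    0 ≤ cutSum Λ a m p t W :=
  Finset.sum_nonneg fun _ _ => Finset.sum_nonneg fun _ _ =>
    mul_nonneg (Z_nonneg _ _ _) (kernel_nonneg _ _ _ _ _ _)

/-- Adjacent honeycomb vertices have centres at distance `≤ 2` (crude; the truth is `1/√3`). -/
theorem norm_hexCenter_sub_le_two {u v : HexVertex} (h : hexGraph.Adj u v) :
    ‖hexCenter u - hexCenter v‖ ≤ 2 := by
  have hre : (hexCenter u - hexCenter v).re = ((pos u : ℝ) - pos v) / 2 := by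
    rw [Complex.sub_re, hexCenter_re, hexCenter_re]; ring
  have hs : Real.sqrt 3 / 2 ≤ 1 := by
    rw [div_le_one (by norm_num : (0:ℝ) < 2)]
    exact (Real.sqrt_lt' (by norm_num : (0:ℝ) < 2) |>.2 (by norm_num : (3:ℝ) < 2 ^ 2)).le
  have hs0 : 0 ≤ Real.sqrt 3 / 2 := by positivity
  have hrow : (row u : ℝ) - row v ≤ 1 ∧ (row v : ℝ) - row u ≤ 1 := by
    rcases (adj_iff u v).1 h with ⟨h1, -⟩ | ⟨-, h1, -⟩ | ⟨-, h1, -⟩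
    · rw [h1]; norm_num
    · constructor <;> (push_cast [h1]; linarith)
    · constructor <;> (push_cast [h1]; linarith)
  have hposd : (pos u : ℝ) - pos v ≤ 1 ∧ (pos v : ℝ) - pos u ≤ 1 := by
    rcases (adj_iff u v).1 h with ⟨-, h1 | h1⟩ | ⟨h1, -⟩ | ⟨h1, -⟩
    · constructor <;> (push_cast [h1]; linarith)
    · constructor <;> (push_cast [h1]; linarith)
    · rw [h1]; norm_num
    · rw [h1]; norm_num
  have hk : ∀ w : HexVertex, (0 : ℝ) ≤ ((w.2 : ℕ) : ℝ) ∧ (((w.2 : ℕ) : ℝ)) ≤ 1 := by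
    intro w
    refine ⟨by positivity, ?_⟩
    have : (w.2 : ℕ) ≤ 1 := by have := w.2.isLt; omega
    exact_mod_cast this
  have him : |(hexCenter u - hexCenter v).im| ≤ 3 / 2 := by
    rw [Complex.sub_im, hexCenter_im, hexCenter_im, abs_le]
    obtain ⟨hu0, hu1⟩ := hk u
    obtain ⟨hv0, hv1⟩ := hk v
    constructor <;> nlinarith
  have hre' : |(hexCenter u - hexCenter v).re| ≤ 1 / 2 := by
    rw [hre, abs_le]; constructor <;> linarith [hposd.1, hposd.2]
  calc ‖hexCenter u - hexCenter v‖
      ≤ |(hexCenter u - hexCenter v).re| + |(hexCenter u - hexCenter v).im| :=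
        Complex.norm_le_abs_re_add_abs_im _
    _ ≤ 1 / 2 + 3 / 2 := add_le_add hre' him
    _ = 2 := by norm_num

/-- An endpoint of an edge is within distance `1` of its midpoint. -/
theorem norm_hexCenter_sub_hexMidpoint_le {u v : HexVertex} (h : hexGraph.Adj u v) :
    ‖hexCenter u - hexMidpoint s(u, v)‖ ≤ 1 := by
  rw [hexMidpoint_mk]
  have : hexCenter u - (hexCenter u + hexCenter v) / 2 = (hexCenter u - hexCenter v) / 2 := by ring
  rw [this, norm_div, Complex.norm_ofNat]
  linarith [norm_hexCenter_sub_le_two h]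

/-- **Frame ⇒ door.** Eventually the marked boundary mid-edge `b_δ` is a door edge of the exact
half-lattice: `b_δ = door (m δ) p` with `(p - m δ) % 2 = 0` and outer endpoint off `Λ_δ`. -/
theorem frame_door {D : DobrushinDomain} {ρ : ℝ} {Λ : ℝ → Finset HexVertex} {m : ℝ → ℤ}
    {a b : ℝ → Sym2 HexVertex} (hρ : 0 < ρ)
    (hev : ∀ᶠ δ : ℝ in nhdsWithin 0 (Set.Ioi 0),
      hexDomainSimplyConnected (Λ δ) ∧ a δ ∈ hexDomainBoundary (Λ δ) ∧
      b δ ∈ hexDomainBoundary (Λ δ) ∧ Nonempty (HexMidEdgeSAW (Λ δ) (a δ) (b δ)) ∧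
      (hexGraph.induce ((Λ δ : Finset HexVertex) : Set HexVertex)).Preconnected ∧
      (∀ v ∈ Λ δ, (δ : ℂ) * hexCenter v ∈ D.carrier) ∧
      (∀ v : HexVertex, (δ : ℂ) * hexCenter v ∈ Metric.ball (D.pt 1) ρ →
        (v ∈ Λ δ ↔ m δ ≤ v.1 1)))
    (hb : Filter.Tendsto (fun δ : ℝ => (δ : ℂ) * hexMidpoint (b δ)) (nhdsWithin 0 (Set.Ioi 0))
      (nhds (D.pt 1))) :
    ∀ᶠ δ : ℝ in nhdsWithin 0 (Set.Ioi 0),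
      ∃ p : ℤ, b δ = door (m δ) p ∧ (p - m δ) % 2 = 0 ∧ bv (m δ - 1) p ∉ Λ δ := by
  have hb' : ∀ᶠ δ : ℝ in nhdsWithin 0 (Set.Ioi 0),
      dist ((δ : ℂ) * hexMidpoint (b δ)) (D.pt 1) < ρ / 2 :=
    Metric.tendsto_nhds.1 hb (ρ / 2) (by positivity)
  have hsmall : ∀ᶠ δ : ℝ in nhdsWithin 0 (Set.Ioi 0), δ < ρ / 2 :=
    mem_nhdsWithin_of_mem_nhds (Iio_mem_nhds (by positivity))
  have hpos : ∀ᶠ δ : ℝ in nhdsWithin 0 (Set.Ioi 0), 0 < δ := eventually_mem_nhdsWithin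
  filter_upwards [hev, hb', hsmall, hpos] with δ hevδ hbδ hδρ hδ
  obtain ⟨-, -, hbd, -, -, -, hrows⟩ := hevδ
  obtain ⟨hedge, u, v, hbuv, hv, hu⟩ := hbd
  have hadj : hexGraph.Adj u v := by
    rw [hbuv] at hedge; exact hedge
  -- both endpoints of `b_δ` have their scaled centres in the ball `B(pt 1, ρ)`
  have hball : ∀ w : HexVertex, w = u ∨ w = v →
      (δ : ℂ) * hexCenter w ∈ Metric.ball (D.pt 1) ρ := by
    intro w hw
    have hw1 : ‖hexCenter w - hexMidpoint (b δ)‖ ≤ 1 := by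
      rcases hw with rfl | rfl
      · rw [hbuv]; exact norm_hexCenter_sub_hexMidpoint_le hadj
      · rw [hbuv, Sym2.eq_swap]; exact norm_hexCenter_sub_hexMidpoint_le hadj.symm
    rw [Metric.mem_ball]
    have hd1 : dist ((δ : ℂ) * hexCenter w) ((δ : ℂ) * hexMidpoint (b δ)) ≤ δ * 1 := by
      rw [dist_eq_norm, ← mul_sub, norm_mul, Complex.norm_real, Real.norm_of_nonneg hδ.le]
      exact mul_le_mul_of_nonneg_left hw1 hδ.le
    calc dist ((δ : ℂ) * hexCenter w) (D.pt 1)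
        ≤ dist ((δ : ℂ) * hexCenter w) ((δ : ℂ) * hexMidpoint (b δ)) +
            dist ((δ : ℂ) * hexMidpoint (b δ)) (D.pt 1) := dist_triangle _ _ _
      _ < δ * 1 + ρ / 2 := add_lt_add_of_le_of_lt hd1 hbδ
      _ < ρ := by linarith
  have hvrow : m δ ≤ row v := (hrows v (hball v (Or.inr rfl))).1 hv
  have hurow : row u < m δ := by
    by_contra hcon
    exact hu ((hrows u (hball u (Or.inl rfl))).2 (not_lt.1 hcon))
  rcases (adj_iff u v).1 hadj with ⟨h1, -⟩ | ⟨-, h1, -⟩ | ⟨h1, h2, h3⟩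
  · exfalso; omega
  · exfalso; omega
  · have hru : row u = m δ - 1 := by omega
    have hrv : row v = m δ := by omega
    have hu' : bv (m δ - 1) (pos v) = u := by rw [← hru, ← h1, bv_row_pos]
    have hv' : bv (m δ) (pos v) = v := by rw [← hrv, bv_row_pos]
    refine ⟨pos v, ?_, ?_, ?_⟩
    · rw [hbuv, door, hu', hv']
    · omega
    · rw [hu']; exact hu

/-- **Frame ⇒ box.** Eventually the lattice rectangle of `2t + 1` rows and half-width `A t`
above the door of `b_δ` lies in `Λ_δ` (it sits inside `B(b, ρ)`, where `Λ_δ` is the exact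
half-lattice by the rows clause), `t = tOf D ρ A δ`. -/
theorem frame_box {D : DobrushinDomain} {ρ : ℝ} {Λ : ℝ → Finset HexVertex} {m : ℝ → ℤ}
    {a b : ℝ → Sym2 HexVertex} (hρ : 0 < ρ)
    (hev : ∀ᶠ δ : ℝ in nhdsWithin 0 (Set.Ioi 0),
      hexDomainSimplyConnected (Λ δ) ∧ a δ ∈ hexDomainBoundary (Λ δ) ∧
      b δ ∈ hexDomainBoundary (Λ δ) ∧ Nonempty (HexMidEdgeSAW (Λ δ) (a δ) (b δ)) ∧
      (hexGraph.induce ((Λ δ : Finset HexVertex) : Set HexVertex)).Preconnected ∧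
      (∀ v ∈ Λ δ, (δ : ℂ) * hexCenter v ∈ D.carrier) ∧
      (∀ v : HexVertex, (δ : ℂ) * hexCenter v ∈ Metric.ball (D.pt 1) ρ →
        (v ∈ Λ δ ↔ m δ ≤ v.1 1)))
    (hb : Filter.Tendsto (fun δ : ℝ => (δ : ℂ) * hexMidpoint (b δ)) (nhdsWithin 0 (Set.Ioi 0))
      (nhds (D.pt 1))) {A : ℕ} (hA : 1 ≤ A) :
    ∀ᶠ δ : ℝ in nhdsWithin 0 (Set.Ioi 0), ∀ p : ℤ, b δ = door (m δ) p →
      Rect (m δ) (m δ + 2 * (tOf D ρ A δ)) (p - (A * tOf D ρ A δ : ℕ)) (p + (A * tOf D ρ A δ : ℕ))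
        ⊆ Λ δ := by
  have hb' : ∀ᶠ δ : ℝ in nhdsWithin 0 (Set.Ioi 0),
      dist ((δ : ℂ) * hexMidpoint (b δ)) (D.pt 1) < ρ / 2 :=
    Metric.tendsto_nhds.1 hb (ρ / 2) (by positivity)
  have hsmall : ∀ᶠ δ : ℝ in nhdsWithin 0 (Set.Ioi 0), δ < ρ / 16 :=
    mem_nhdsWithin_of_mem_nhds (Iio_mem_nhds (by positivity))
  have hpos : ∀ᶠ δ : ℝ in nhdsWithin 0 (Set.Ioi 0), 0 < δ := eventually_mem_nhdsWithin
  filter_upwards [hev, hb', hsmall, hpos] with δ hevδ hbδ hδρ hδ p hbp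
  obtain ⟨-, -, -, -, -, -, hrows⟩ := hevδ
  have hρ0 : rho0 D ρ ≤ ρ := min_le_left _ _
  have hρ0' : 0 ≤ rho0 D ρ := le_min hρ.le dist_nonneg
  have hA' : (1 : ℝ) ≤ A := by exact_mod_cast hA
  have hA0 : (0 : ℝ) ≤ A := by positivity
  have ht0 : (0 : ℝ) ≤ (tOf D ρ A δ : ℝ) := by positivity
  -- `δ A t ≤ ρ₀ / 32`
  have htδ : δ * (A : ℝ) * (tOf D ρ A δ : ℝ) ≤ rho0 D ρ / 32 := by
    have h1 : ((tOf D ρ A δ : ℕ) : ℝ) ≤ rho0 D ρ / (32 * (A : ℝ) * δ) := by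
      unfold tOf; exact Nat.floor_le (by positivity)
    rw [le_div_iff₀ (by positivity)] at h1
    nlinarith
  intro v hv
  rw [mem_Rect] at hv
  obtain ⟨hr1, hr2, hp1, hp2⟩ := hv
  apply (hrows v ?_).2 hr1
  -- the scaled centre of `v` is within `ρ` of `pt 1`
  rw [Metric.mem_ball]
  have hmid_re : ((δ : ℂ) * hexMidpoint (b δ)).re = δ * ((p : ℝ) + 1) / 2 := by
    rw [hbp, door, Complex.re_ofReal_mul, mid_re, pos_bv, pos_bv]; ring
  have hmid_im_lo : δ * hgt * ((m δ : ℝ) - 1 + 1 / 3) ≤ ((δ : ℂ) * hexMidpoint (b δ)).im := by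
    rw [hbp, door, Complex.im_ofReal_mul, mid_im]
    have h1 := hexCenter_im_ge (bv (m δ - 1) p)
    have h2 := hexCenter_im_ge (bv (m δ) p)
    rw [row_bv] at h1 h2
    rw [show Real.sqrt 3 / 2 = hgt from rfl] at h1 h2
    push_cast at h1 h2 ⊢
    nlinarith [hgt_pos]
  have hmid_im_hi : ((δ : ℂ) * hexMidpoint (b δ)).im ≤ δ * hgt * ((m δ : ℝ) + 2 / 3) := by
    rw [hbp, door, Complex.im_ofReal_mul, mid_im]
    have h1 := hexCenter_im_le (bv (m δ - 1) p)
    have h2 := hexCenter_im_le (bv (m δ) p)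
    rw [row_bv] at h1 h2
    rw [show Real.sqrt 3 / 2 = hgt from rfl] at h1 h2
    push_cast at h1 h2 ⊢
    nlinarith [hgt_pos]
  have hv_re : ((δ : ℂ) * hexCenter v).re = δ * ((pos v : ℝ) + 1) / 2 := re_scaled δ v
  have hv_im_lo := im_scaled_ge δ hδ.le v
  have hv_im_hi := im_scaled_le δ hδ.le v
  have hr1' : (m δ : ℝ) ≤ row v := by exact_mod_cast hr1
  have hr2' : (row v : ℝ) ≤ m δ + 2 * (tOf D ρ A δ : ℝ) := by exact_mod_cast hr2
  have hp1' : (p : ℝ) - (A : ℝ) * (tOf D ρ A δ : ℝ) ≤ pos v := by exact_mod_cast hp1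
  have hp2' : (pos v : ℝ) ≤ p + (A : ℝ) * (tOf D ρ A δ : ℝ) := by exact_mod_cast hp2
  have hh := hgt_lt
  have hh0 := hgt_pos
  have hδh : 0 ≤ δ * hgt := by positivity
  have hδt : 0 ≤ δ * (tOf D ρ A δ : ℝ) := by positivity
  have hdre : |((δ : ℂ) * hexCenter v - (δ : ℂ) * hexMidpoint (b δ)).re| ≤
      δ * (A : ℝ) * (tOf D ρ A δ : ℝ) / 2 := by
    rw [Complex.sub_re, hv_re, hmid_re, abs_le]
    constructor <;> nlinarith [mul_le_mul_of_nonneg_left hp1' hδ.le, mul_le_mul_of_nonneg_left hp2' hδ.le]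
  have hdim : |((δ : ℂ) * hexCenter v - (δ : ℂ) * hexMidpoint (b δ)).im| ≤
      δ * (2 * (tOf D ρ A δ : ℝ) + 2) := by
    rw [Complex.sub_im, abs_le]
    have k1 : δ * hgt * ((row v : ℝ) + 2 / 3) - δ * hgt * ((m δ : ℝ) - 1 + 1 / 3) ≤
        δ * (2 * (tOf D ρ A δ : ℝ) + 2) := by
      nlinarith [mul_le_mul_of_nonneg_left hr2' hδh, mul_le_mul_of_nonneg_left hh.le hδt,
        mul_le_mul_of_nonneg_left hh.le hδ.le]
    have k2 : -(δ * (2 * (tOf D ρ A δ : ℝ) + 2)) ≤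
        δ * hgt * ((row v : ℝ) + 1 / 3) - δ * hgt * ((m δ : ℝ) + 2 / 3) := by
      nlinarith [mul_le_mul_of_nonneg_left hr1' hδh, mul_le_mul_of_nonneg_left hh.le hδ.le]
    constructor <;> linarith
  have h2 : δ * (tOf D ρ A δ : ℝ) ≤ δ * (A : ℝ) * (tOf D ρ A δ : ℝ) := by
    nlinarith [mul_le_mul_of_nonneg_left hA' hδt]
  have hdist : dist ((δ : ℂ) * hexCenter v) ((δ : ℂ) * hexMidpoint (b δ)) ≤ ρ / 4 := by
    rw [dist_eq_norm]
    calc ‖(δ : ℂ) * hexCenter v - (δ : ℂ) * hexMidpoint (b δ)‖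
        ≤ |((δ : ℂ) * hexCenter v - (δ : ℂ) * hexMidpoint (b δ)).re| +
            |((δ : ℂ) * hexCenter v - (δ : ℂ) * hexMidpoint (b δ)).im| :=
          Complex.norm_le_abs_re_add_abs_im _
      _ ≤ δ * (A : ℝ) * (tOf D ρ A δ : ℝ) / 2 + δ * (2 * (tOf D ρ A δ : ℝ) + 2) :=
          add_le_add hdre hdim
      _ ≤ ρ / 4 := by nlinarith
  calc dist ((δ : ℂ) * hexCenter v) (D.pt 1)
      ≤ dist ((δ : ℂ) * hexCenter v) ((δ : ℂ) * hexMidpoint (b δ)) +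
          dist ((δ : ℂ) * hexMidpoint (b δ)) (D.pt 1) := dist_triangle _ _ _
    _ < ρ / 4 + ρ / 2 := add_lt_add_of_le_of_lt hdist hbδ
    _ < ρ := by linarith

/-- The lattice scale diverges: `t(δ) ≥ t₃` eventually. -/
theorem eventually_le_tOf (D : DobrushinDomain) {ρ : ℝ} (hρ : 0 < ρ) (A t₃ : ℕ) (hA : 1 ≤ A) :
    ∀ᶠ δ : ℝ in nhdsWithin 0 (Set.Ioi 0), t₃ ≤ tOf D ρ A δ := by
  have h01 : (0 : Fin 2) ≠ 1 := by decide
  have hρ0 : 0 < rho0 D ρ :=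
    lt_min hρ (dist_pos.2 fun h => h01 (D.pt_injective h))
  have hA' : (1 : ℝ) ≤ A := by exact_mod_cast hA
  have hcpos : 0 < rho0 D ρ / (32 * (A : ℝ) * ((t₃ : ℝ) + 1)) := by positivity
  have hsmall : ∀ᶠ δ : ℝ in nhdsWithin 0 (Set.Ioi 0),
      δ < rho0 D ρ / (32 * (A : ℝ) * ((t₃ : ℝ) + 1)) :=
    mem_nhdsWithin_of_mem_nhds (Iio_mem_nhds hcpos)
  have hpos : ∀ᶠ δ : ℝ in nhdsWithin 0 (Set.Ioi 0), 0 < δ := eventually_mem_nhdsWithin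
  filter_upwards [hsmall, hpos] with δ hδc hδ
  unfold tOf
  apply Nat.le_floor
  rw [le_div_iff₀ (by positivity)]
  rw [lt_div_iff₀ (by positivity)] at hδc
  nlinarith

/-! ## Composition: the line concludes the crux by name -/

end Glue

open Glue in
/-- **The line concludes the crux from its three open statements** (hypotheses inlined verbatim =
the registered stubs 2, 4, 5, so that this composition can be LANDED as a Theorems file).
`RenewalBlock` feeds the LANDED b-side module (`stub_blockModule stub_bridgeDictionary stub_renewalSurgery`),
giving a floor `p₁ ≤ boxMass(t, W(t))` at every scale `t ≥ t₁` and every door; lateral confinement moves the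
floor to the aspect window `A·t` (`p₁/2 ≤ boxMass(t, A t)`); in the crux frame, eventually `b_δ` is a door
(`frame_door`), the box above it lies in `Λ_δ` (`frame_box`) and `t(δ) ≥ t₃` (`eventually_le_tOf`); the
LANDED renewal cut bounds the cut sum by `Z(a_δ → b_δ)`; the arc mass ratio bounds `δ²Σ_K Z · boxMass`
by `C δ^{-3/4} ·` the cut sum; divide by `boxMass ≥ p₁/2`. -/
theorem massRatio_of_hyps :
    (∃ p₀ : ℝ, 0 < p₀ ∧ ∃ t₀ : ℕ, ∀ t : ℕ, t₀ ≤ t →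
      p₀ * ∑ s ∈ Finset.Icc 1 t, HV.stripBlim s ≤ ∑ s ∈ Finset.Icc t (2 * t), HV.stripBlim s) →
    (∀ ε : ℝ, 0 < ε → ∃ A : ℕ, 1 ≤ A ∧ ∃ t₂ : ℕ, ∀ t : ℕ, t₂ ≤ t →
      ∀ (W : ℕ) (m p : ℤ), (p - m) % 2 = 0 → boxMass m p t W ≤ boxMass m p t (A * t) + ε) →
    (∀ A : ℕ, 1 ≤ A →
      ∀ (D : DobrushinDomain) (ρ : ℝ) (Λ : ℝ → Finset HexVertex) (m : ℝ → ℤ)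
        (a b : ℝ → Sym2 HexVertex),
        0 < ρ →
        D.carrier ∩ Metric.ball (D.pt 1) ρ = {z : ℂ | (D.pt 1).im < z.im} ∩ Metric.ball (D.pt 1) ρ →
        (∀ᶠ δ : ℝ in nhdsWithin 0 (Set.Ioi 0),
          hexDomainSimplyConnected (Λ δ) ∧ a δ ∈ hexDomainBoundary (Λ δ) ∧
            b δ ∈ hexDomainBoundary (Λ δ) ∧ Nonempty (HexMidEdgeSAW (Λ δ) (a δ) (b δ)) ∧
            (hexGraph.induce ((Λ δ : Finset HexVertex) : Set HexVertex)).Preconnected ∧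
            (∀ v ∈ Λ δ, (δ : ℂ) * hexCenter v ∈ D.carrier) ∧
            (∀ v : HexVertex, (δ : ℂ) * hexCenter v ∈ Metric.ball (D.pt 1) ρ →
              (v ∈ Λ δ ↔ m δ ≤ v.1 1))) →
        (∀ K : Set ℂ, IsCompact K → K ⊆ D.carrier → ∀ᶠ δ : ℝ in nhdsWithin 0 (Set.Ioi 0),
          ∀ v : HexVertex, (δ : ℂ) * hexCenter v ∈ K → v ∈ Λ δ) →
        Filter.Tendsto (fun δ : ℝ => (δ : ℂ) * hexMidpoint (a δ)) (nhdsWithin 0 (Set.Ioi 0))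
          (nhds (D.pt 0)) →
        Filter.Tendsto (fun δ : ℝ => (δ : ℂ) * hexMidpoint (b δ)) (nhdsWithin 0 (Set.Ioi 0))
          (nhds (D.pt 1)) →
        ∀ K : Set ℂ, IsCompact K → K ⊆ D.carrier → ∃ C : ℝ,
          ∀ᶠ δ : ℝ in nhdsWithin 0 (Set.Ioi 0), ∀ p : ℤ, b δ = door (m δ) p →
            δ ^ 2 * (∑ᶠ e ∈ {e : Sym2 HexVertex | e ∈ hexDomainMidEdges (Λ δ) ∧
                (δ : ℂ) * hexMidpoint e ∈ K}, Z (Λ δ) (a δ) e) *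
                boxMass (m δ) p (tOf D ρ A δ) (A * tOf D ρ A δ) ≤
              C * δ ^ (-(3 : ℝ) / 4) * cutSum (Λ δ) (a δ) (m δ) p (tOf D ρ A δ) (A * tOf D ρ A δ)) →
    MassRatio := by
  intro hRB0 hLC0 hAMR0
  -- b-side constants from stubs 2–4
  obtain ⟨p₀, hp₀, t₀, hRB⟩ := hRB0
  have hBM := stub_blockModule stub_bridgeDictionary stub_renewalSurgery p₀ t₀ hp₀ hRB
  unfold BoxMassFloor at hBM
  obtain ⟨p₁, hp₁, t₁, hK⟩ := hBM
  obtain ⟨A, hA, t₂, hLC⟩ := hLC0 (p₁ / 2) (by positivity)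
  have hmass : ∀ t : ℕ, max (max t₁ t₂) 1 ≤ t → ∀ m p : ℤ, (p - m) % 2 = 0 →
      p₁ / 2 ≤ boxMass m p t (A * t) := by
    intro t ht m p hpar
    obtain ⟨W, hW⟩ := hK t (le_trans (le_trans (le_max_left _ _) (le_max_left _ _)) ht)
    have h1 := hW m p hpar
    have h2 := hLC t (le_trans (le_trans (le_max_right _ _) (le_max_left _ _)) ht) W m p hpar
    linarith
  intro D ρ Λ m a b Zc hρ hflat hev hexh ha hb K hK hKD
  obtain ⟨C, hC⟩ := hAMR0 A hA D ρ Λ m a b hρ hflat hev hexh ha hb K hK hKD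
  refine ⟨max C 0 * (2 / p₁), ?_⟩
  have hpos : ∀ᶠ δ : ℝ in nhdsWithin 0 (Set.Ioi 0), 0 < δ := eventually_mem_nhdsWithin
  filter_upwards [hC, frame_door hρ hev hb, frame_box hρ hev hb hA,
    eventually_le_tOf D hρ A (max (max t₁ t₂) 1) hA, hpos] with δ hCδ hdoor hboxδ htδ hδ
  obtain ⟨p, hbp, hpar, hout⟩ := hdoor
  have ht1 : 1 ≤ tOf D ρ A δ := le_trans (le_max_right _ _) htδ
  -- stub 1 at the frame's box
  have hcut : cutSum (Λ δ) (a δ) (m δ) p (tOf D ρ A δ) (A * tOf D ρ A δ) ≤ Z (Λ δ) (a δ) (b δ) := by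
    rw [hbp]
    exact stub_renewalCut (Λ δ) (a δ) (m δ) p (tOf D ρ A δ) (A * tOf D ρ A δ) ht1 (hboxδ p hbp) hout
  have hm : p₁ / 2 ≤ boxMass (m δ) p (tOf D ρ A δ) (A * tOf D ρ A δ) := hmass _ htδ (m δ) p hpar
  have hCδ' := hCδ p hbp
  -- notation
  have hZc : ∀ e, ‖Zc δ e‖ = Z (Λ δ) (a δ) e := fun e => rfl
  simp only [hZc]
  set S : ℝ := δ ^ 2 * ∑ᶠ e ∈ {e : Sym2 HexVertex | e ∈ hexDomainMidEdges (Λ δ) ∧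
      (δ : ℂ) * hexMidpoint e ∈ K}, Z (Λ δ) (a δ) e with hS
  set M : ℝ := boxMass (m δ) p (tOf D ρ A δ) (A * tOf D ρ A δ) with hM
  have hMpos : 0 < M := lt_of_lt_of_le (by positivity) hm
  have hrpow : (0 : ℝ) ≤ δ ^ (-(3 : ℝ) / 4) := (Real.rpow_pos_of_pos hδ _).le
  have hZb : 0 ≤ Z (Λ δ) (a δ) (b δ) := Z_nonneg _ _ _
  have hcs := cutSum_nonneg (Λ δ) (a δ) (m δ) p (tOf D ρ A δ) (A * tOf D ρ A δ)
  have hX0 : 0 ≤ max C 0 * δ ^ (-(3 : ℝ) / 4) * Z (Λ δ) (a δ) (b δ) :=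
    mul_nonneg (mul_nonneg (le_max_right _ _) hrpow) hZb
  -- S * M ≤ max C 0 * δ^{-3/4} * Z(b_δ)
  have h1 : S * M ≤ max C 0 * δ ^ (-(3 : ℝ) / 4) * Z (Λ δ) (a δ) (b δ) :=
    calc S * M ≤ C * δ ^ (-(3 : ℝ) / 4) *
          cutSum (Λ δ) (a δ) (m δ) p (tOf D ρ A δ) (A * tOf D ρ A δ) := hCδ'
      _ ≤ max C 0 * δ ^ (-(3 : ℝ) / 4) *
          cutSum (Λ δ) (a δ) (m δ) p (tOf D ρ A δ) (A * tOf D ρ A δ) :=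
          mul_le_mul_of_nonneg_right (mul_le_mul_of_nonneg_right (le_max_left _ _) hrpow) hcs
      _ ≤ max C 0 * δ ^ (-(3 : ℝ) / 4) * Z (Λ δ) (a δ) (b δ) :=
          mul_le_mul_of_nonneg_left hcut (mul_nonneg (le_max_right _ _) hrpow)
  -- divide by M ≥ p₁ / 2
  have h2 : S ≤ max C 0 * δ ^ (-(3 : ℝ) / 4) * Z (Λ δ) (a δ) (b δ) / M := by
    rw [le_div_iff₀ hMpos]; exact h1
  have h3 : M⁻¹ ≤ 2 / p₁ := by
    rw [inv_le_comm₀ hMpos (by positivity), inv_div]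
    exact hm
  calc S ≤ max C 0 * δ ^ (-(3 : ℝ) / 4) * Z (Λ δ) (a δ) (b δ) / M := h2
    _ = max C 0 * δ ^ (-(3 : ℝ) / 4) * Z (Λ δ) (a δ) (b δ) * M⁻¹ := div_eq_mul_inv _ _
    _ ≤ max C 0 * δ ^ (-(3 : ℝ) / 4) * Z (Λ δ) (a δ) (b δ) * (2 / p₁) :=
        mul_le_mul_of_nonneg_left h3 hX0
    _ = max C 0 * (2 / p₁) * δ ^ (-(3 : ℝ) / 4) * Z (Λ δ) (a δ) (b δ) := by ring


end Summit.CriticalPhenomena.SAWScalingLimit.Theorems.MassRatio.Renewal
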